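import Literature.NumberTheory.Automorphic.FiniteAdeleSchrodingerFactorwise
import Literature.NumberTheory.Automorphic.UnitaryGroupSymplecticLocalization
import Literature.NumberTheory.Weil1964.AdelicMetaplecticFiniteImplementer
import Literature.NumberTheory.Weil1964.ArchSchrodingerFollandDictionary
import HarnessLib

-- buildfix G11b-3 recipe (LEDGER B13-1/B13-3): elaborate sequentially so the trailing `attribute [implicit_reducible]`
-- block (reducibilityCoreExt is keyed to the async environment branch) is in force at `.olean` export.
set_option Elab.async false

/-!
# The finite-adelic half of the Weil-representation splitting over a unitary group, assembled place by place

[GelbartRogawski1991, §3.1 Prop. 3.1.1 p. 455, lines 1–3 of the proof]: "at each place `v` … a homomorphism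
`s_v : G_v → Mp(W_v)` … the product `∏_v s_v` defines the splitting over `G(𝐀_f)`"; the restricted tensor product
`𝐫_𝐀 = ⊗_v 𝐫_v` of the local metaplectic representations is [Weil1964, Chap. III n° 37–38]; smoothness of the
restricted product representation is [MoeglinVignerasWaldspurger1987, Chap. 2 II.8] / Flath.

Topic `NumberTheory/GelbartRogawski1991`; namespace `Literature.NumberTheory.GelbartRogawski1991.UnitaryDualPair.LocalSplitting`
(that of `LocalUnitarySplittingDatum`). KERNEL MATHEMATICS ONLY: one Type-valued data structure (`FinLocalSplittings`, the
family of local splittings a caller supplies — e.g. `(𝓓 v).localSplitting` of `LocalSplittingDatum`), definitions with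
bodies, theorems; no `Prop`-valued record, no named fact, no `sorry`.

Setting: `E/F` quadratic, `c`, `δ` (`c δ = -δ ≠ 0`, `δ² = d`), an `F`-rational symmetric Gram matrix `T ∈ Sym_N(F)` with
`J = T ⊗ 1`, the adelic Gram matrix `𝕋 = T ⊗ 1 ∈ M_N(𝔸_F)`, the global Schrödinger representation
`ρ = adelicSchrodinger F (Fin N) 𝕋` on `𝒮(𝔸_F^N) = 𝓢 ⊗ 𝒮_f`, Weil's group of implementing pairs `Mp_ψ(𝕎_𝔸) = adelicMp` and
its LF-continuous part `adelicMpCont`, the embedding `ι_𝔸 : U(J)(𝔸_F) → Sp(𝕎_𝔸)` (`UnitaryGroup.adelicToSymplectic`) and,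
at each finite place, the local Schrödinger model `ρ_v`, `S̃p_{ψ_v}(𝕎_v) = LocalMp F N T v` and `ι_v` (`iota`).

* §1 `FinLocalSplittings`: local splittings `s_v : U(J)(F_v) →* S̃p_{ψ_v}(𝕎_v)` over `ι_v`, smooth, unramified almost
  everywhere; the local Weil representations `ω_v = (toRep) ∘ s_v` and their restricted tensor product
  `Ω = ⊗'_v ω_v` on `𝒮_f = 𝒮((𝔸_F^∞)^N)` (`FiniteAdeleWeilAssembly.finiteAdeleRep` through `finAdelicEquiv`), with
  `Ω(g) (⊗_v Φ_v) = ⊗_v ω_v(g_v) Φ_v`.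
* §2 local ↔ global bookkeeping at a place `v`: the adelic form, Weil's second-degree character `f_σ` of
  `σ = ι_𝔸(1, g)` and its place components `f_{ι_v g_v}`; the central character on `𝒮_f`.
* §3 **`implements`**: `1 ⊗ Ω(g)` implements `σ = ι_𝔸(1, g)` on ALL of `H(𝕎_𝔸)`: on the finite Heisenberg elements by
  the factorwise action `finOp_piProdSB`, the local implementer property of `s_v(g_v)` and §2; on the archimedean ones
  because `ρ` acts there by `A ⊗ 1` and `σ` fixes the archimedean vectors; in general by `h = h_∞ · h_f`.
* §4 **`finSplitting : U(J)(𝔸_{F,f}) →* Mp_ψ(𝕎_𝔸)ᶜᵒⁿᵗ`**, `g ↦ (ι_𝔸(1, g), 1 ⊗ Ω(g))`, with `π ∘ finSplitting = ι_𝔸 ∘ (1, ·)`,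
  `ω ∘ finSplitting = 1 ⊗ Ω`, and continuity (coefficient topology: orbit maps of `π` by
  `continuous_adelicToSymplectic_finAdelicToAdelic_apply`, matrix coefficients locally constant since `Ω` is smooth).
-/

set_option autoImplicit false

noncomputable section

open scoped Matrix TensorProduct Classical RestrictedProduct
open NumberField NumberField.mixedEmbedding IsDedekindDomain Filter
open Literature.RepresentationTheory.HeisenbergGroup
open Literature.NumberTheory.Automorphic
open Literature.NumberTheory.Weil1964

namespace Literature.NumberTheory.GelbartRogawski1991.UnitaryDualPair.LocalSplitting

variable (F : Type) [Field F] [NumberField F] (E : Type) [Field E] [NumberField E] [Algebra F E]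
  [Algebra.IsQuadraticExtension F E] (c : E ≃ₐ[F] E) (N : ℕ) {δ : E} (hcδ : c δ = -δ) (hδ : δ ≠ 0) {d : F}
  (hd : δ * δ = algebraMap F E d) (T : Matrix (Fin N) (Fin N) F) (hT : T.IsSymm)
  {J : Matrix (Fin N) (Fin N) E} (hJ : J = T.map (algebraMap F E))

set_option quotPrecheck false in
/-- the adelic Gram matrix `𝕋 = T ⊗ 1`. -/
local notation "𝕋" => Matrix.map T (algebraMap F (AdeleRing (𝓞 F) F))

/-! ## §1 Local ↔ global bookkeeping at a finite place -/

section Bookkeeping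

/-- the symplectic element `σ(g) = ι_𝔸(1, g) ∈ Sp(𝕎_𝔸)` of a finite-adelic `g` (a homomorphism in `g`).
[cite: GelbartRogawski1991, §3.1 p. 454] -/
def spFin : UnitaryGroup.finAdelic F E c N J →* symplecticGroup (polar (Weil1964.adelicForm F (Fin N) 𝕋)) :=
  (UnitaryGroup.adelicToSymplectic F E c N hcδ hδ hd hT hJ).comp (UnitaryGroup.finAdelicToAdelic F E c N J)

/-- unfolding of `spFin`. [cite: GelbartRogawski1991, §3.1 p. 454] -/
theorem spFin_apply (g : UnitaryGroup.finAdelic F E c N J) :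
    spFin F E c N hcδ hδ hd T hT hJ g =
      UnitaryGroup.adelicToSymplectic F E c N hcδ hδ hd hT hJ
        (UnitaryGroup.finAdelicToAdelic F E c N J g : UnitaryGroup.adelic F E c N J) := rfl

/-- components of principal adeles: `(q ⊗ 1)_v = q`. [folklore] -/
private theorem adeleEval_algebraMap (v : HeightOneSpectrum (𝓞 F)) (q : F) :
    AdelicGroupData.adeleEval F v (algebraMap F (AdeleRing (𝓞 F) F) q) = algebraMap F (v.adicCompletion F) q := by
  rw [AdelicGroupData.adeleEval_apply]
  exact FiniteAdeleRing.algebraMap_apply (𝓞 F) F q v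

/-- `𝕋` read at `v` is the local Gram matrix `T ⊗ F_v`. [folklore] -/
private theorem map_adeleEval_gram (v : HeightOneSpectrum (𝓞 F)) :
    (𝕋).map (AdelicGroupData.adeleEval F v) = localGram F N T v := by
  refine Matrix.ext fun i j => ?_
  simp only [Matrix.map_apply]
  exact adeleEval_algebraMap F v (T i j)

/-- **the adelic form read at `v` is the local form**: `β_𝕋(x, y)_v = β_{T_v}(x_v, y_v)`. [cite: Weil1964, Chap. III n° 37 p. 188] -/
theorem adeleEval_adelicForm (v : HeightOneSpectrum (𝓞 F)) (x y : Fin N → AdeleRing (𝓞 F) F) :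
    AdelicGroupData.adeleEval F v (Weil1964.adelicForm F (Fin N) 𝕋 x y) =
      localPairing F N T v (fun i => (x i).2 v) (fun i => (y i).2 v) := by
  rw [Weil1964.adelicForm_apply, Matrix.toLinearMap₂'_apply', RingHom.map_dotProduct]
  congr 1
  funext i
  rw [Function.comp_apply, RingHom.map_mulVec, map_adeleEval_gram]
  rfl

/-- `⅟2 ∈ 𝔸_F` read at `v` is `⅟2 ∈ F_v`. [folklore] -/
private theorem adeleEval_invOf_two (v : HeightOneSpectrum (𝓞 F)) :
    AdelicGroupData.adeleEval F v (⅟(2 : AdeleRing (𝓞 F) F)) = ⅟(2 : v.adicCompletion F) := by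
  have h : AdelicGroupData.adeleEval F v (⅟(2 : AdeleRing (𝓞 F) F)) * 2 = 1 := by
    rw [← map_ofNat (AdelicGroupData.adeleEval F v) 2, ← map_mul, invOf_mul_self, map_one]
  exact (invOf_eq_left_inv h).symm

/-- **Weil's second-degree character localises**: for `σ = ι_𝔸(1, g)`,
`f_σ(w)_v = f_{ι_v g_v}(w_v)` with `f_σ(w) = ½ (β(σw, σw) − β(w, w))`. [cite: Weil1964, Chap. I n° 5 pp. 150–151] -/
theorem adeleEval_ofSymplectic_f (v : HeightOneSpectrum (𝓞 F)) (g : UnitaryGroup.finAdelic F E c N J)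
    (w : (Fin N → AdeleRing (𝓞 F) F) × (Fin N → AdeleRing (𝓞 F) F)) :
    AdelicGroupData.adeleEval F v
        ((ofSymplectic _ (spFin F E c N hcδ hδ hd T hT hJ g)).f w) =
      (ofSymplectic (polar (localPairing F N T v))
          (iota F E c N hcδ hδ hd T hT hJ v (UnitaryGroup.evalPlace F E c N J v g))).f (UnitaryGroup.placeVec F N v w) := by
  rw [ofSymplectic_f, ofSymplectic_f, map_mul, map_sub, adeleEval_invOf_two, polar_apply, polar_apply, polar_apply,
    polar_apply, adeleEval_adelicForm, adeleEval_adelicForm, iota_def, spFin_apply,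
    ← UnitaryGroup.adelicToSymplectic_finAdelicToAdelic_apply_place]
  rfl

/-- the archimedean part of `β_𝕋(x, y)` vanishes when `y` has zero archimedean part. [folklore] -/
private theorem fst_adelicForm_eq_zero (x y : Fin N → AdeleRing (𝓞 F) F) (hy : ∀ i, (y i).1 = 0) :
    UnitaryGroup.adeleFst F (Weil1964.adelicForm F (Fin N) 𝕋 x y) = 0 := by
  rw [Weil1964.adelicForm_apply, RingHom.map_dotProduct]
  have h : (UnitaryGroup.adeleFst F) ∘ (𝕋 *ᵥ y) = 0 := by
    funext j
    rw [Function.comp_apply, RingHom.map_mulVec]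
    have hy' : (UnitaryGroup.adeleFst F) ∘ y = 0 := funext fun i => hy i
    rw [hy', Matrix.mulVec_zero]
  rw [h, dotProduct_zero]

/-- a finite Heisenberg element has vectors with zero archimedean parts. [folklore] -/
private theorem fst_eq_zero_of_mem_finHeisenberg {h : AdelicHeisenberg F (Fin N) 𝕋} (hh : h ∈ finHeisenberg 𝕋) (i : Fin N) :
    (h.v.1 i).1 = 0 ∧ (h.v.2 i).1 = 0 := by
  rw [mem_finHeisenberg_iff] at hh
  have h1 := congrFun (congrArg Prod.fst hh) i
  have h2 := congrFun (congrArg Prod.snd hh) i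
  simp only [Prod.smul_fst, Prod.smul_snd, Pi.smul_apply, smul_eq_mul] at h1 h2
  exact ⟨(finIdem_mul_eq_self_iff _).1 h1, (finIdem_mul_eq_self_iff _).1 h2⟩

/-- **on finite Heisenberg elements the second-degree character has zero archimedean part.** [cite: Weil1964, Chap. I n° 5 pp. 150–151] -/
theorem fst_ofSymplectic_f_eq_zero (σ : symplecticGroup (polar (Weil1964.adelicForm F (Fin N) 𝕋)))
    {h : AdelicHeisenberg F (Fin N) 𝕋} (hh : h ∈ finHeisenberg 𝕋) : ((ofSymplectic _ σ).f h.v).1 = 0 := by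
  have hh' : (ofSymplectic _ σ).act h ∈ finHeisenberg 𝕋 := act_mem_finHeisenberg _ hh
  have e1 : UnitaryGroup.adeleFst F (Weil1964.adelicForm F (Fin N) 𝕋 (σ.1 h.v).1 (σ.1 h.v).2) = 0 :=
    fst_adelicForm_eq_zero F N T _ _ fun i => (fst_eq_zero_of_mem_finHeisenberg F N T hh' i).2
  have e2 : UnitaryGroup.adeleFst F (Weil1964.adelicForm F (Fin N) 𝕋 h.v.1 h.v.2) = 0 :=
    fst_adelicForm_eq_zero F N T _ _ fun i => (fst_eq_zero_of_mem_finHeisenberg F N T hh i).2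
  change UnitaryGroup.adeleFst F ((ofSymplectic _ σ).f h.v) = 0
  rw [ofSymplectic_f, polar_apply, polar_apply, map_mul, map_sub, e1, e2, sub_zero, mul_zero]

/-- `ψ_F(a) = ψ_f(a_f)` for an adele with zero archimedean part. [cite: Tate1967, §4.1] -/
theorem adeleAddChar_eq_finiteAdeleAddChar_of_fst_eq_zero {a : AdeleRing (𝓞 F) F} (ha : a.1 = 0) :
    adeleAddChar F a = finiteAdeleAddChar F a.2 := by
  rw [finiteAdeleAddChar_eq_comp, finiteAdeleInr_apply]
  exact congrArg _ (Prod.ext ha rfl)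

/-- the local central character: `ρ_v(w, t) = ψ_v(t) · ρ_v(w, 0)`. [cite: MoeglinVignerasWaldspurger1987, Chap. 2 I.2] -/
theorem localSchrodinger_mk_eq_smul (v : HeightOneSpectrum (𝓞 F))
    (w : (Fin N → v.adicCompletion F) × (Fin N → v.adicCompletion F)) (t : v.adicCompletion F)
    (f : SchwartzBruhat (Fin N → v.adicCompletion F)) :
    localSchrodinger F N T v ⟨w, t⟩ f = ((adeleAddCharAt F v t : Circle) : ℂ) • localSchrodinger F N T v ⟨w, 0⟩ f := by
  apply Subtype.ext
  funext u
  rw [localSchrodinger_apply, Submodule.coe_smul, Pi.smul_apply, smul_eq_mul, localSchrodinger_apply, zero_add,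
    AddChar.map_add_eq_mul, Circle.coe_mul, mul_assoc]

/-- **scalar families factor out of pure tensors**: if `Y_v = ψ_v(a_v) · Z_v` for all `v` then
`⊗_v Y_v = ψ_f(a) · ⊗_v Z_v`. [cite: Weil1964, Chap. III n° 37 p. 188] -/
theorem piProdSB_eq_smul_of_forall (Y Z : LocalSBFamily F (Fin N)) (a : FiniteAdeleRing (𝓞 F) F)
    (hYZ : ∀ v, (Y v : SchwartzBruhat (Fin N → v.adicCompletion F)) =
      ((adeleAddCharAt F v (a v) : Circle) : ℂ) • (Z v : SchwartzBruhat (Fin N → v.adicCompletion F))) :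
    piProdSB F (Fin N) Y = ((finiteAdeleAddChar F a : Circle) : ℂ) • piProdSB F (Fin N) Z := by
  apply Subtype.ext
  funext b
  rw [Submodule.coe_smul, Pi.smul_apply, smul_eq_mul, coe_piProdSB, coe_piProdSB]
  obtain ⟨Sb, hSb⟩ := exists_finset_integral b
  obtain ⟨Sa, hSa⟩ := exists_finset_integral (fun _ : Fin 1 => a)
  set S : Finset (HeightOneSpectrum (𝓞 F)) :=
    (finite_setOf_ne_unitVec Y).toFinset ∪ (finite_setOf_ne_unitVec Z).toFinset ∪ Sb ∪ Sa with hS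
  have hY : ∀ v ∉ S, Y v = unitVec F (Fin N) v := fun v hv => by
    by_contra hne
    exact hv (Finset.mem_union_left _ (Finset.mem_union_left _ (Finset.mem_union_left _
      ((finite_setOf_ne_unitVec Y).mem_toFinset.2 hne))))
  have hZ : ∀ v ∉ S, Z v = unitVec F (Fin N) v := fun v hv => by
    by_contra hne
    exact hv (Finset.mem_union_left _ (Finset.mem_union_left _ (Finset.mem_union_right _
      ((finite_setOf_ne_unitVec Z).mem_toFinset.2 hne))))
  have hb : ∀ v ∉ S, ∀ i, b i v ∈ v.adicCompletionIntegers F := fun v hv =>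
    hSb v fun hv' => hv (Finset.mem_union_left _ (Finset.mem_union_right _ hv'))
  have ha : ∀ v ∉ S, a v ∈ v.adicCompletionIntegers F := fun v hv =>
    hSa v (fun hv' => hv (Finset.mem_union_right _ hv')) 0
  rw [piProd_eq_prod Y b S hY hb, piProd_eq_prod Z b S hZ hb, finiteAdeleAddChar_eq_prod F a S ha,
    ← Circle.coeHom_apply, map_prod, ← Finset.prod_mul_distrib]
  refine Finset.prod_congr rfl fun v _ => ?_
  rw [Circle.coeHom_apply, localFactor_apply, localFactor_apply, hYZ v, Submodule.coe_smul, Pi.smul_apply, smul_eq_mul]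

/-- **every Heisenberg element is `h_∞ · h_f`** with `h_∞` archimedean (central part `0`) and `h_f` finite
(`𝔸_F = F_∞ × 𝔸_F^∞`). [cite: Weil1964, Chap. III n° 37 p. 188] -/
theorem exists_eq_arch_mul_fin {ι : Type} [Fintype ι] [DecidableEq ι] (T' : Matrix ι ι (AdeleRing (𝓞 F) F))
    (h : AdelicHeisenberg F ι T') :
    ∃ (a w : ι → mixedSpace F) (hf : AdelicHeisenberg F ι T'), hf ∈ finHeisenberg T' ∧
      h = (⟨(archVec F ι a, archVec F ι w), 0⟩ : AdelicHeisenberg F ι T') * hf := by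
  refine ⟨piArch F ι h.v.1, piArch F ι h.v.2,
    (⟨(archVec F ι (piArch F ι h.v.1), archVec F ι (piArch F ι h.v.2)), 0⟩ : AdelicHeisenberg F ι T')⁻¹ * h, ?_,
    (mul_inv_cancel_left _ _).symm⟩
  rw [mem_finHeisenberg_iff, Heisenberg.mul_v, Heisenberg.inv_v]
  have key : ∀ x : ι → AdeleRing (𝓞 F) F, -archVec F ι (piArch F ι x) + x = piAdeleSplit F ι (0, piFinite F ι x) := by
    intro x
    conv_lhs => rw [eq_piAdeleSplit F ι x]
    rw [archVec, ← map_neg, ← map_add, Prod.neg_mk, neg_zero, Prod.mk_add_mk, zero_add, piArch_piAdeleSplit,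
      neg_add_cancel]
  rw [Prod.neg_mk, Prod.mk_add_mk, key, key, Prod.smul_mk, finIdem_smul_piAdeleSplit_zero, finIdem_smul_piAdeleSplit_zero]

/-- `1 ⊗ ·` on linear automorphisms of `𝒮_f`, as a homomorphism. [folklore] -/
def tensorFinHom : (FinSB F (Fin N) ≃ₗ[ℂ] FinSB F (Fin N)) →* (piSchwartzBruhat F (Fin N) ≃ₗ[ℂ] piSchwartzBruhat F (Fin N)) where
  toFun := adelicTensorAutFin F (Fin N)
  map_one' := by
    refine LinearEquiv.toLinearMap_injective ?_
    rw [coe_adelicTensorAutFin, LinearEquiv.coe_toLinearMap_one, LinearEquiv.coe_toLinearMap_one]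
    exact adelicTensorEnd_id
  map_mul' A B := by
    refine LinearEquiv.toLinearMap_injective ?_
    rw [coe_adelicTensorAutFin, LinearEquiv.coe_toLinearMap_mul, LinearEquiv.coe_toLinearMap_mul, coe_adelicTensorAutFin,
      coe_adelicTensorAutFin, ← adelicTensorEnd_mul]
    exact (congrArg (fun X => adelicTensorEnd X
      ((A : FinSB F (Fin N) →ₗ[ℂ] FinSB F (Fin N)) * (B : FinSB F (Fin N) →ₗ[ℂ] FinSB F (Fin N))))
      ((Module.End.mul_eq_comp _ _).trans (LinearMap.id_comp _))).symm

/-- unfolding of `tensorFinHom`. [cite: Weil1964, Chap. III n° 38 p. 190] -/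
@[simp] theorem tensorFinHom_apply (B : FinSB F (Fin N) ≃ₗ[ℂ] FinSB F (Fin N)) :
    tensorFinHom F N B = adelicTensorAutFin F (Fin N) B := rfl

end Bookkeeping

/-! ## §2 Local splittings, local Weil representations, `Ω = ⊗'_v ω_v` -/

/-- **A restricted family of LOCAL SPLITTINGS** `s_v : U(J)(F_v) →* S̃p_{ψ_v}(𝕎_v)` over the embeddings `ι_v`
(`proj_s`), each SMOOTH (every Schwartz–Bruhat function has an open stabiliser under `ω_v = toRep ∘ s_v`), and
UNRAMIFIED almost everywhere (`U(J)(𝒪_v)` fixes `1_{𝒪_vᴺ}`) — the data the finite-adelic splitting is assembled from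
(e.g. `s v := (𝓓 v).localSplitting` for a family of `LocalSplittingDatum`s). A Type-valued DATA structure to be
instantiated, not a hypothesis of an end theorem. [cite: GelbartRogawski1991, §3.1 Prop. 3.1.1 p. 455 L1–3] -/
structure FinLocalSplittings where
  /-- the local splitting at `v` -/
  s : ∀ v : HeightOneSpectrum (𝓞 F), UnitaryGroup.localPi E c N J v →* LocalMp F N T v
  /-- `π ∘ s_v = ι_v` -/
  proj_s : ∀ (v : HeightOneSpectrum (𝓞 F)) (g : UnitaryGroup.localPi E c N J v),
    MpPsi.proj _ (s v g) = iota F E c N hcδ hδ hd T hT hJ v g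
  /-- `ω_v = toRep ∘ s_v` is smooth -/
  smooth : ∀ v : HeightOneSpectrum (𝓞 F), Representation.IsSmooth ((MpPsi.toRep (localSchrodinger F N T v)).comp (s v))
  /-- the unramified clause: `ω_v(k) 1_{𝒪_vᴺ} = 1_{𝒪_vᴺ}` for `k ∈ U(J)(𝒪_v)`, for almost all `v` -/
  unramified : ∀ᶠ v in cofinite, ∀ k ∈ UnitaryGroup.localInt E c N J v,
    MpPsi.toRep (localSchrodinger F N T v) (s v k) (unitVec F (Fin N) v) = unitVec F (Fin N) v

namespace FinLocalSplittings

variable {F E c N hcδ hδ hd T hT hJ}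
variable (𝓢 : FinLocalSplittings F E c N hcδ hδ hd T hT hJ)

/-- the local Weil representation `ω_v = toRep ∘ s_v` of `U(J)(F_v)` on `𝒮(F_vᴺ)`. [cite: MoeglinVignerasWaldspurger1987, Chap. 2 II.1] -/
def omegaLoc (v : HeightOneSpectrum (𝓞 F)) :
    Representation ℂ (UnitaryGroup.localPi E c N J v) (SchwartzBruhat (Fin N → v.adicCompletion F)) :=
  (MpPsi.toRep (localSchrodinger F N T v)).comp (𝓢.s v)

/-- `ω_v(g) Φ = M Φ` for `s_v(g) = (ι_v g, M)`. [cite: MoeglinVignerasWaldspurger1987, Chap. 2 II.1] -/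
theorem omegaLoc_apply (v : HeightOneSpectrum (𝓞 F)) (g : UnitaryGroup.localPi E c N J v)
    (Φ : SchwartzBruhat (Fin N → v.adicCompletion F)) :
    𝓢.omegaLoc v g Φ = ((𝓢.s v g : LocalMp F N T v) : LocalSp F N T v ×
      (SchwartzBruhat (Fin N → v.adicCompletion F) ≃ₗ[ℂ] SchwartzBruhat (Fin N → v.adicCompletion F))).2 Φ := rfl

/-- the symplectic component of `s_v(g)` is `ι_v g`. [cite: GelbartRogawski1991, §3.1 Prop. 3.1.1 p. 455 L1–3] -/
theorem fst_s (v : HeightOneSpectrum (𝓞 F)) (g : UnitaryGroup.localPi E c N J v) :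
    ((𝓢.s v g : LocalMp F N T v) : LocalSp F N T v ×
      (SchwartzBruhat (Fin N → v.adicCompletion F) ≃ₗ[ℂ] SchwartzBruhat (Fin N → v.adicCompletion F))).1 =
      iota F E c N hcδ hδ hd T hT hJ v g := by
  rw [← MpPsi.proj_apply]; exact 𝓢.proj_s v g

/-- `s_v(g)` implements `ι_v g` on `𝒮(F_vᴺ)`: `ω_v(g) ρ_v(h) = ρ_v(ι_v(g) · h) ω_v(g)`. [cite: MoeglinVignerasWaldspurger1987, Chap. 2 II.1 (A)] -/
theorem omegaLoc_implements (v : HeightOneSpectrum (𝓞 F)) (g : UnitaryGroup.localPi E c N J v)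
    (h : Heisenberg (polar (localPairing F N T v))) (Φ : SchwartzBruhat (Fin N → v.adicCompletion F)) :
    𝓢.omegaLoc v g (localSchrodinger F N T v h Φ) =
      localSchrodinger F N T v ((ofSymplectic _ (iota F E c N hcδ hδ hd T hT hJ v g)).act h) (𝓢.omegaLoc v g Φ) := by
  have himp := (mem_MpPsi (localSchrodinger F N T v) _).1 (𝓢.s v g).2
  rw [fst_s] at himp
  exact himp h Φ

/-- `ω_v` is smooth. [cite: MoeglinVignerasWaldspurger1987, Chap. 2 II.8] -/
theorem isSmooth_omegaLoc (v : HeightOneSpectrum (𝓞 F)) : (𝓢.omegaLoc v).IsSmooth := 𝓢.smooth v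

/-- the base vectors are `U(J)(𝒪_v)`-fixed for almost all `v`. [cite: GelbartRogawski1991, §3.1 (3.1.3) p. 456] -/
theorem unitVec_mem_fixedPoints :
    ∀ᶠ v in cofinite, unitVec F (Fin N) v ∈ (𝓢.omegaLoc v).fixedPoints (UnitaryGroup.localInt E c N J v) :=
  𝓢.unramified.mono fun _ hv => (Representation.mem_fixedPoints _ _ _).2 fun k hk => hv k hk

/-- **`Ω = ⊗'_v ω_v`** on `𝒮((𝔸_F^∞)ᴺ)`, as a representation of `Πʳ_v [U(J)(F_v), U(J)(𝒪_v)]`.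
[cite: Weil1964, Chap. III n° 37–38 pp. 188–190] -/
def OmegaPi : Representation ℂ (Πʳ v : HeightOneSpectrum (𝓞 F), [UnitaryGroup.localPi E c N J v, UnitaryGroup.localInt E c N J v])
    (FinSB F (Fin N)) :=
  finiteAdeleRep F (Fin N) 𝓢.omegaLoc 𝓢.unitVec_mem_fixedPoints

/-- **`Ω` on `U(J)(𝔸_{F,f})`** through `finAdelicEquiv : U(J)(𝔸_{F,f}) ≃ₜ* Πʳ_v [U(J)(F_v), U(J)(𝒪_v)]`.
[cite: GelbartRogawski1991, §3.1 Prop. 3.1.1 p. 455 L1–3] -/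
def Omega : Representation ℂ (UnitaryGroup.finAdelic F E c N J) (FinSB F (Fin N)) :=
  𝓢.OmegaPi.comp (UnitaryGroup.finAdelicEquiv F E c N J).toMulEquiv.toMonoidHom

/-- unfolding of `Ω`. [cite: GelbartRogawski1991, §3.1 Prop. 3.1.1 p. 455 L1–3] -/
theorem Omega_apply (g : UnitaryGroup.finAdelic F E c N J) (f : FinSB F (Fin N)) :
    𝓢.Omega g f = 𝓢.OmegaPi (UnitaryGroup.finAdelicEquiv F E c N J g) f := rfl

/-- **`Ω(g)` on pure tensors**: `Ω(g) (⊗_v Φ_v) = ⊗_v ω_v(g_v) Φ_v`. [cite: Weil1964, Chap. III n° 37–38 pp. 188–190] -/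
theorem Omega_piProdSB (g : UnitaryGroup.finAdelic F E c N J) (Φ : LocalSBFamily F (Fin N)) :
    𝓢.Omega g (piProdSB F (Fin N) Φ) =
      piProdSB F (Fin N) (RestrictedFamily.smul 𝓢.omegaLoc 𝓢.unitVec_mem_fixedPoints
        (UnitaryGroup.finAdelicEquiv F E c N J g) Φ) :=
  finiteAdeleRep_apply_piProdSB F (Fin N) 𝓢.omegaLoc 𝓢.unitVec_mem_fixedPoints _ Φ

/-- coordinates of the acted family: `(g • Φ)_v = ω_v(g_v) Φ_v`, `g_v = evalPlace v g`. [cite: Weil1964, Chap. III n° 37–38 pp. 188–190] -/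
theorem smul_apply (g : UnitaryGroup.finAdelic F E c N J) (Φ : LocalSBFamily F (Fin N)) (v : HeightOneSpectrum (𝓞 F)) :
    RestrictedFamily.smul 𝓢.omegaLoc 𝓢.unitVec_mem_fixedPoints (UnitaryGroup.finAdelicEquiv F E c N J g) Φ v =
      𝓢.omegaLoc v (UnitaryGroup.evalPlace F E c N J v g) (Φ v) := rfl

/-- `g ↦ Ω(g) f` is locally constant on `U(J)(𝔸_{F,f})`. [cite: MoeglinVignerasWaldspurger1987, Chap. 2 II.8] -/
theorem isLocallyConstant_Omega_apply (f : FinSB F (Fin N)) :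
    IsLocallyConstant fun g : UnitaryGroup.finAdelic F E c N J => 𝓢.Omega g f := by
  haveI : Fact (∀ v : HeightOneSpectrum (𝓞 F),
      IsOpen (UnitaryGroup.localInt E c N J v : Set (UnitaryGroup.localPi E c N J v))) :=
    ⟨fun v => UnitaryGroup.isOpen_localInt E c N J v⟩
  exact (isLocallyConstant_finiteAdeleRep_apply F (Fin N) 𝓢.omegaLoc 𝓢.unitVec_mem_fixedPoints 𝓢.isSmooth_omegaLoc
    f).comp_continuous (UnitaryGroup.finAdelicEquiv F E c N J).continuous

/-- `Ω` as a homomorphism to the linear automorphisms of `𝒮_f`. [cite: GelbartRogawski1991, §3.1 Prop. 3.1.1 p. 455 L1–3] -/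
def OmegaEquiv : UnitaryGroup.finAdelic F E c N J →* (FinSB F (Fin N) ≃ₗ[ℂ] FinSB F (Fin N)) :=
  (LinearMap.GeneralLinearGroup.generalLinearEquiv ℂ (FinSB F (Fin N))).toMonoidHom.comp 𝓢.Omega.asGroupHom

/-- `OmegaEquiv g = Ω(g)` as a linear map. [cite: GelbartRogawski1991, §3.1 Prop. 3.1.1 p. 455 L1–3] -/
@[simp] theorem coe_OmegaEquiv (g : UnitaryGroup.finAdelic F E c N J) :
    (𝓢.OmegaEquiv g : FinSB F (Fin N) →ₗ[ℂ] FinSB F (Fin N)) = 𝓢.Omega g := by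
  change ((LinearMap.GeneralLinearGroup.generalLinearEquiv ℂ (FinSB F (Fin N)) (𝓢.Omega.asGroupHom g)) :
    FinSB F (Fin N) →ₗ[ℂ] FinSB F (Fin N)) = _
  rw [LinearMap.GeneralLinearGroup.generalLinearEquiv_to_linearMap, Representation.asGroupHom_apply]

/-- `OmegaEquiv g f = Ω(g) f`. [cite: GelbartRogawski1991, §3.1 Prop. 3.1.1 p. 455 L1–3] -/
@[simp] theorem OmegaEquiv_apply (g : UnitaryGroup.finAdelic F E c N J) (f : FinSB F (Fin N)) :
    𝓢.OmegaEquiv g f = 𝓢.Omega g f := by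
  rw [← LinearEquiv.coe_coe, coe_OmegaEquiv]

/-! ## §3 `1 ⊗ Ω(g)` implements `ι_𝔸(1, g)` on the global Schrödinger model -/

section Implements

/-- **place components of the two families**: `ω_v(g_v) ρ_v(h_v) Φ_v = ψ_v(f_σ(w)_v) · ρ_v((σh)_v) ω_v(g_v) Φ_v`.
[cite: Weil1964, Chap. III n° 37–38 pp. 188–190] -/
theorem smul_heisFamily_apply (g : UnitaryGroup.finAdelic F E c N J) (h : AdelicHeisenberg F (Fin N) 𝕋)
    (Φ : LocalSBFamily F (Fin N)) (v : HeightOneSpectrum (𝓞 F)) :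
    (RestrictedFamily.smul 𝓢.omegaLoc 𝓢.unitVec_mem_fixedPoints (UnitaryGroup.finAdelicEquiv F E c N J g)
        (heisFamily T h Φ) v : SchwartzBruhat (Fin N → v.adicCompletion F)) =
      ((adeleAddCharAt F v (((ofSymplectic _
          (spFin F E c N hcδ hδ hd T hT hJ g)).f h.v).2 v) : Circle) : ℂ) •
        (heisFamily T ((ofSymplectic (polar (Weil1964.adelicForm F (Fin N) 𝕋)) (spFin F E c N hcδ hδ hd T hT hJ g)).act h) (RestrictedFamily.smul 𝓢.omegaLoc 𝓢.unitVec_mem_fixedPoints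
          (UnitaryGroup.finAdelicEquiv F E c N J g) Φ) v : SchwartzBruhat (Fin N → v.adicCompletion F)) := by
  rw [smul_apply, heisFamily_apply, heisFamily_apply, smul_apply, omegaLoc_implements]
  -- the acted local element
  have hact : (ofSymplectic (polar (localPairing F N T v))
      (iota F E c N hcδ hδ hd T hT hJ v (UnitaryGroup.evalPlace F E c N J v g))).act (heisLoc T h v) =
      ⟨(heisLoc T ((ofSymplectic (polar (Weil1964.adelicForm F (Fin N) 𝕋)) (spFin F E c N hcδ hδ hd T hT hJ g)).act h) v).v, ((ofSymplectic _
          (spFin F E c N hcδ hδ hd T hT hJ g)).f h.v).2 v⟩ := by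
    refine Heisenberg.ext ?_ ?_
    · rw [Heisenberg.PseudoSymplectic.act_v, ofSymplectic_σ]
      change (iota F E c N hcδ hδ hd T hT hJ v (UnitaryGroup.evalPlace F E c N J v g)).1
          (UnitaryGroup.placeVec F N v h.v) =
        UnitaryGroup.placeVec F N v ((spFin F E c N hcδ hδ hd T hT hJ g).1 h.v)
      rw [iota_def, spFin_apply, UnitaryGroup.adelicToSymplectic_finAdelicToAdelic_apply_place]
    · rw [Heisenberg.PseudoSymplectic.act_t]
      change (0 : v.adicCompletion F) + _ =
        AdelicGroupData.adeleEval F v ((ofSymplectic _ (spFin F E c N hcδ hδ hd T hT hJ g)).f h.v)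
      rw [zero_add, adeleEval_ofSymplectic_f F E c N hcδ hδ hd T hT hJ]
      rfl
  rw [hact]
  exact localSchrodinger_mk_eq_smul F N T v _ _ _

/-- **finite Heisenberg elements**: `(1 ⊗ Ω(g)) ρ(h) = ρ(σ h) (1 ⊗ Ω(g))` for `h ∈ finHeisenberg`, on the finite factor.
[cite: Weil1964, Chap. III n° 37–38 pp. 188–190] -/
theorem Omega_comp_finSchrodinger (g : UnitaryGroup.finAdelic F E c N J) {h : AdelicHeisenberg F (Fin N) 𝕋}
    (hh : h ∈ finHeisenberg 𝕋) :
    𝓢.Omega g ∘ₗ finSchrodinger 𝕋 h = finSchrodinger 𝕋 ((ofSymplectic (polar (Weil1964.adelicForm F (Fin N) 𝕋)) (spFin F E c N hcδ hδ hd T hT hJ g)).act h) ∘ₗ 𝓢.Omega g := by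
  refine LinearMap.ext_on_range (span_range_piProdSB (K := F) (ι := Fin N)) fun Φ => ?_
  rw [LinearMap.comp_apply, LinearMap.comp_apply, finSchrodinger_def, finSchrodinger_def, LinearMap.smul_apply,
    LinearMap.smul_apply, map_smul, finOp_piProdSB, Omega_piProdSB, Omega_piProdSB, finOp_piProdSB,
    piProdSB_eq_smul_of_forall F N _ _ (((ofSymplectic _
      (spFin F E c N hcδ hδ hd T hT hJ g)).f h.v).2) (𝓢.smul_heisFamily_apply g h Φ),
    smul_smul, Heisenberg.PseudoSymplectic.act_t, AddChar.map_add_eq_mul, Circle.coe_mul,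
    adeleAddChar_eq_finiteAdeleAddChar_of_fst_eq_zero F (fst_ofSymplectic_f_eq_zero F N T _ hh)]

/-- **finite Heisenberg elements, global form.** [cite: Weil1964, Chap. III n° 37–38 pp. 188–190] -/
theorem implements_of_mem_finHeisenberg (g : UnitaryGroup.finAdelic F E c N J) {h : AdelicHeisenberg F (Fin N) 𝕋}
    (hh : h ∈ finHeisenberg 𝕋) (Φ : piSchwartzBruhat F (Fin N)) :
    adelicTensorEnd LinearMap.id (𝓢.Omega g) (adelicSchrodinger F (Fin N) 𝕋 h Φ) =
      adelicSchrodinger F (Fin N) 𝕋 ((ofSymplectic (polar (Weil1964.adelicForm F (Fin N) 𝕋)) (spFin F E c N hcδ hδ hd T hT hJ g)).act h) (adelicTensorEnd LinearMap.id (𝓢.Omega g) Φ) := by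
  rw [adelicSchrodinger_eq_adelicTensorEnd_finSchrodinger hh,
    adelicSchrodinger_eq_adelicTensorEnd_finSchrodinger (act_mem_finHeisenberg _ hh), ← LinearMap.comp_apply,
    ← LinearMap.comp_apply (adelicTensorEnd _ _), ← adelicTensorEnd_comp, ← adelicTensorEnd_comp,
    Omega_comp_finSchrodinger _ g hh]

/-- **archimedean Heisenberg elements**: `ρ(archVec a, archVec w, t)` acts by `A ⊗ 1` and `σ` fixes these elements, so
`1 ⊗ Ω(g)` commutes past. [cite: Weil1964, Chap. I n° 4 p. 149] -/
theorem implements_arch (g : UnitaryGroup.finAdelic F E c N J) (a w : Fin N → mixedSpace F) (t : AdeleRing (𝓞 F) F)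
    (Φ : piSchwartzBruhat F (Fin N)) :
    adelicTensorEnd LinearMap.id (𝓢.Omega g)
        (adelicSchrodinger F (Fin N) 𝕋 (⟨(archVec F (Fin N) a, archVec F (Fin N) w), t⟩ : AdelicHeisenberg F (Fin N) 𝕋) Φ) =
      adelicSchrodinger F (Fin N) 𝕋 ((ofSymplectic (polar (Weil1964.adelicForm F (Fin N) 𝕋)) (spFin F E c N hcδ hδ hd T hT hJ g)).act ⟨(archVec F (Fin N) a, archVec F (Fin N) w), t⟩)
        (adelicTensorEnd LinearMap.id (𝓢.Omega g) Φ) := by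
  have hfix : (spFin F E c N hcδ hδ hd T hT hJ g).1
      (archVec F (Fin N) a, archVec F (Fin N) w) = (archVec F (Fin N) a, archVec F (Fin N) w) :=
    UnitaryGroup.adelicToSymplectic_finAdelicToAdelic_apply_eq_self F E c N hcδ hδ hd hT hJ g _
      (fun i => archVec_apply_snd a i) (fun i => archVec_apply_snd w i)
  have hact : (ofSymplectic (polar (Weil1964.adelicForm F (Fin N) 𝕋)) (spFin F E c N hcδ hδ hd T hT hJ g)).act ⟨(archVec F (Fin N) a, archVec F (Fin N) w), t⟩ =
      (⟨(archVec F (Fin N) a, archVec F (Fin N) w), t⟩ : AdelicHeisenberg F (Fin N) 𝕋) := by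
    refine Heisenberg.ext ?_ ?_
    · rw [Heisenberg.PseudoSymplectic.act_v, ofSymplectic_σ]
      exact hfix
    · rw [Heisenberg.PseudoSymplectic.act_t, ofSymplectic_f]
      change t + _ = t
      rw [hfix, sub_self, mul_zero, add_zero]
  rw [hact, ← LinearMap.comp_apply, ← LinearMap.comp_apply (adelicSchrodinger F (Fin N) 𝕋 _)]
  refine congrFun (congrArg DFunLike.coe (linearMap_ext_tensor (K := F) (ι := Fin N) fun Φinf f => ?_)) Φ
  rw [LinearMap.comp_apply, LinearMap.comp_apply, adelicSchrodinger_mk_archVec_tmul, map_smul,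
    adelicTensorEnd_apply_tmul, adelicTensorEnd_apply_tmul, adelicSchrodinger_mk_archVec_tmul, LinearMap.id_apply,
    LinearMap.id_apply]

/-- **`1 ⊗ Ω(g)` IMPLEMENTS `ι_𝔸(1, g)`** on the global Schrödinger model `𝒮(𝔸_Fᴺ)`: condition (A) for every Heisenberg element.
[cite: MoeglinVignerasWaldspurger1987, Chap. 2 II.1 (A); Weil1964, Chap. III n° 37–38 pp. 188–190] -/
theorem implements (g : UnitaryGroup.finAdelic F E c N J) :
    Implements (adelicSchrodinger F (Fin N) 𝕋)
      (ofSymplectic _ (spFin F E c N hcδ hδ hd T hT hJ g))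
      (adelicTensorAutFin F (Fin N) (𝓢.OmegaEquiv g)) := by
  intro h Φ
  obtain ⟨a, w, hf, hhf, rfl⟩ := exists_eq_arch_mul_fin F 𝕋 h
  have e : (adelicTensorAutFin F (Fin N) (𝓢.OmegaEquiv g) : piSchwartzBruhat F (Fin N) → piSchwartzBruhat F (Fin N)) =
      adelicTensorEnd LinearMap.id (𝓢.Omega g) := by
    funext Ψ
    rw [← LinearEquiv.coe_coe, coe_adelicTensorAutFin, coe_OmegaEquiv]
  rw [e, map_mul, Module.End.mul_apply, Heisenberg.PseudoSymplectic.act_mul, map_mul, Module.End.mul_apply,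
    𝓢.implements_arch g a w 0, 𝓢.implements_of_mem_finHeisenberg g hhf]

end Implements

/-! ## §4 The finite-adelic splitting `g ↦ (ι_𝔸(1, g), 1 ⊗ Ω(g))` -/

section Splitting

/-- the pair map `g ↦ (ι_𝔸(1, g), 1 ⊗ Ω(g))`. [cite: GelbartRogawski1991, §3.1 Prop. 3.1.1 p. 455 L1–3] -/
def pairHom : UnitaryGroup.finAdelic F E c N J →*
    symplecticGroup (polar (Weil1964.adelicForm F (Fin N) 𝕋)) × (piSchwartzBruhat F (Fin N) ≃ₗ[ℂ] piSchwartzBruhat F (Fin N)) :=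
  MonoidHom.prod (spFin F E c N hcδ hδ hd T hT hJ) ((tensorFinHom F N).comp 𝓢.OmegaEquiv)

/-- the pair map lands in `Mp_ψ(𝕎_𝔸)`. [cite: MoeglinVignerasWaldspurger1987, Chap. 2 II.1 (A)] -/
theorem pairHom_mem (g : UnitaryGroup.finAdelic F E c N J) : 𝓢.pairHom g ∈ adelicMp F (Fin N) 𝕋 :=
  (mem_MpPsi _ _).2 (𝓢.implements g)

/-- the splitting into `Mp_ψ(𝕎_𝔸)`. [cite: GelbartRogawski1991, §3.1 Prop. 3.1.1 p. 455 L1–3] -/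
def finSplittingMp : UnitaryGroup.finAdelic F E c N J →* adelicMp F (Fin N) 𝕋 :=
  (𝓢.pairHom).codRestrict _ 𝓢.pairHom_mem

/-- the operator of `finSplittingMp g` is `1 ⊗ Ω(g)`. [cite: Weil1964, Chap. III n° 37–38 pp. 188–190] -/
theorem toOp_finSplittingMp (g : UnitaryGroup.finAdelic F E c N J) :
    MpPsi.toOp _ (𝓢.finSplittingMp g) = adelicTensorAutFin F (Fin N) (𝓢.OmegaEquiv g) := rfl

/-- the symplectic component of `finSplittingMp g` is `ι_𝔸(1, g)`. [cite: GelbartRogawski1991, §3.1 p. 454] -/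
theorem proj_finSplittingMp (g : UnitaryGroup.finAdelic F E c N J) :
    MpPsi.proj _ (𝓢.finSplittingMp g) = spFin F E c N hcδ hδ hd T hT hJ g := rfl

/-- the splitting has LF-continuous operators `1 ⊗ Ω(g)`. [cite: GelbartRogawski1991, §3.1 p. 454] -/
theorem finSplittingMp_mem (g : UnitaryGroup.finAdelic F E c N J) : 𝓢.finSplittingMp g ∈ adelicMpCont F (Fin N) 𝕋 := by
  refine mem_adelicMpCont_of_tensor _ (ContinuousLinearMap.id ℂ _) (ContinuousLinearMap.id ℂ _)
    (𝓢.OmegaEquiv g : FinSB F (Fin N) →ₗ[ℂ] FinSB F (Fin N)) ((𝓢.OmegaEquiv g).symm : FinSB F (Fin N) →ₗ[ℂ] FinSB F (Fin N))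
    (fun Φ => ?_) (fun Φ => ?_)
  · rw [toOp_finSplittingMp, ContinuousLinearMap.coe_id, ← LinearEquiv.coe_coe, coe_adelicTensorAutFin]
  · rw [toOp_finSplittingMp, ContinuousLinearMap.coe_id, ← LinearEquiv.coe_coe, coe_adelicTensorAutFin_symm]

/-- **THE FINITE-ADELIC SPLITTING** `s_f : U(J)(𝔸_{F,f}) →* Mp_ψ(𝕎_𝔸)ᶜᵒⁿᵗ`, `g ↦ (ι_𝔸(1, g), 1 ⊗ ⊗'_v ω_v(g_v))`.
[cite: GelbartRogawski1991, §3.1 Prop. 3.1.1 p. 455 L1–3] -/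
def finSplitting : UnitaryGroup.finAdelic F E c N J →* adelicMpCont F (Fin N) 𝕋 :=
  (𝓢.finSplittingMp).codRestrict _ 𝓢.finSplittingMp_mem

/-- `π(s_f(g)) = ι_𝔸(1, g)`. [cite: GelbartRogawski1991, §3.1 Prop. 3.1.1 p. 455 L1–3] -/
theorem proj_finSplitting (g : UnitaryGroup.finAdelic F E c N J) :
    adelicMpCont.proj F (Fin N) 𝕋 (𝓢.finSplitting g) =
      UnitaryGroup.adelicToSymplectic F E c N hcδ hδ hd hT hJ
        (UnitaryGroup.finAdelicToAdelic F E c N J g : UnitaryGroup.adelic F E c N J) := rfl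

/-- `s_f(g)` in `Mp_ψ(𝕎_𝔸)` is `finSplittingMp g`. [cite: GelbartRogawski1991, §3.1 Prop. 3.1.1 p. 455 L1–3] -/
theorem coe_finSplitting (g : UnitaryGroup.finAdelic F E c N J) :
    ((𝓢.finSplitting g : adelicMpCont F (Fin N) 𝕋) : adelicMp F (Fin N) 𝕋) = 𝓢.finSplittingMp g := rfl

/-- `ω(s_f(g)) = 1 ⊗ Ω(g)` as a linear map. [cite: Weil1964, Chap. III n° 37–38 pp. 188–190] -/
theorem omega_finSplitting (g : UnitaryGroup.finAdelic F E c N J) :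
    (adelicMpCont.omega F (Fin N) 𝕋 (𝓢.finSplitting g) : piSchwartzBruhat F (Fin N) →ₗ[ℂ] piSchwartzBruhat F (Fin N)) =
      adelicTensorEnd LinearMap.id (𝓢.Omega g) := by
  apply LinearMap.ext
  intro Φ
  rw [adelicMpCont.omega_apply, omegaPsi_apply, coe_finSplitting, ← MpPsi.toOp_apply, toOp_finSplittingMp,
    ← coe_OmegaEquiv, ← coe_adelicTensorAutFin, LinearEquiv.coe_coe]

/-- `ω(s_f(g)) Φ = (1 ⊗ Ω(g)) Φ`. [cite: Weil1964, Chap. III n° 37–38 pp. 188–190] -/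
theorem omega_finSplitting_apply (g : UnitaryGroup.finAdelic F E c N J) (Φ : piSchwartzBruhat F (Fin N)) :
    adelicMpCont.omega F (Fin N) 𝕋 (𝓢.finSplitting g) Φ = adelicTensorEnd LinearMap.id (𝓢.Omega g) Φ :=
  LinearMap.congr_fun (𝓢.omega_finSplitting g) Φ

/-- `ω(s_f(g)) (Φ_∞ ⊗ f) = Φ_∞ ⊗ Ω(g) f` — the operators of the finite half are FINITE. [cite: Weil1964, Chap. III n° 37–38 pp. 188–190] -/
theorem omega_finSplitting_tmul (g : UnitaryGroup.finAdelic F E c N J) (Φinf : SchwartzMap (Fin N → mixedSpace F) ℂ)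
    (f : FinSB F (Fin N)) :
    adelicMpCont.omega F (Fin N) 𝕋 (𝓢.finSplitting g) (piSchwartzBruhatEquiv F (Fin N) (Φinf ⊗ₜ f)) =
      piSchwartzBruhatEquiv F (Fin N) (Φinf ⊗ₜ 𝓢.Omega g f) :=
  (𝓢.omega_finSplitting_apply g _).trans ((adelicTensorEnd_apply_tmul _ _ Φinf f).trans (by rw [LinearMap.id_apply]))

/-- the operator of `s_f(g)` is `1 ⊗ B` for a linear `B` (namely `Ω(g)`). [cite: Weil1964, Chap. III n° 37–38 pp. 188–190] -/
theorem exists_omega_finSplitting_eq (g : UnitaryGroup.finAdelic F E c N J) :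
    ∃ B : FinSB F (Fin N) →ₗ[ℂ] FinSB F (Fin N),
      (adelicMpCont.omega F (Fin N) 𝕋 (𝓢.finSplitting g) : piSchwartzBruhat F (Fin N) →ₗ[ℂ] piSchwartzBruhat F (Fin N)) =
        adelicTensorEnd LinearMap.id B :=
  ⟨𝓢.Omega g, 𝓢.omega_finSplitting g⟩

/-- the matrix coefficients `g ↦ (ω(s_f(g)) Φ)(x)` are locally constant. [cite: MoeglinVignerasWaldspurger1987, Chap. 2 II.8] -/
theorem isLocallyConstant_omega_finSplitting (Φ : piSchwartzBruhat F (Fin N)) :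
    IsLocallyConstant fun g : UnitaryGroup.finAdelic F E c N J => adelicMpCont.omega F (Fin N) 𝕋 (𝓢.finSplitting g) Φ := by
  have hfun : (fun g : UnitaryGroup.finAdelic F E c N J => adelicMpCont.omega F (Fin N) 𝕋 (𝓢.finSplitting g) Φ) =
      fun g => adelicTensorEnd LinearMap.id (𝓢.Omega g) Φ := funext fun g => 𝓢.omega_finSplitting_apply g Φ
  rw [hfun]
  clear hfun
  obtain ⟨t, rfl⟩ : ∃ t, Φ = piSchwartzBruhatEquiv F (Fin N) t := ⟨_, (LinearEquiv.apply_symm_apply _ Φ).symm⟩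
  induction t using TensorProduct.induction_on with
  | zero =>
    simp only [map_zero]
    exact IsLocallyConstant.const _
  | tmul Φinf f =>
    simp only [adelicTensorEnd_apply_tmul, LinearMap.id_apply]
    exact (𝓢.isLocallyConstant_Omega_apply f).comp fun f' => piSchwartzBruhatEquiv F (Fin N) (Φinf ⊗ₜ f')
  | add x y hx hy =>
    simp only [map_add]
    exact hx.add hy

/-- **`s_f` is continuous** (coefficient topology of `Mp_ψ(𝕎_𝔸)ᶜᵒⁿᵗ`). [cite: GelbartRogawski1991, §3.1 Prop. 3.1.1 p. 455] -/
theorem continuous_finSplitting : Continuous 𝓢.finSplitting := by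
  refine continuous_induced_rng.2 ((continuous_into_adelicMp_iff _).2 ⟨fun w => ?_, fun Φ x => ?_⟩)
  · exact UnitaryGroup.continuous_adelicToSymplectic_finAdelicToAdelic_apply F E c hcδ hδ N hd hT hJ w
  · exact ((𝓢.isLocallyConstant_omega_finSplitting Φ).comp fun Ψ : piSchwartzBruhat F (Fin N) =>
      (Ψ : (Fin N → AdeleRing (𝓞 F) F) → ℂ) x).continuous

end Splitting

/-! ### Build-lane note (ops-buildfix G11b-3 recipe, LEDGER B13-1, 2026-08-21)
`lean -o` (the hub build lane, never `lean`/the gate check) runs Lean 4.32's library-suggestion indexers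
(`Lean.LibrarySuggestions.SymbolFrequency` / `SineQuaNon`, from their `exportEntriesFn`) over the statement of
every local theorem that is not a denied premise; on this family's statements (very large dependent binder
telescopes through the theta-kernel / dual-pair data) that fold runs for tens of minutes to hours and the build
lane kills the job (incident G11b-3, run/shared/lean/ops/buildfix/G11b-3-DOSSIER.md). `isDeniedPremise` skips
`[implicit_reducible]` constants before any fold, and a reducibility status on a *theorem* is inert (Meta never
unfolds `thmInfo`; the kernel ignores the attribute), so the public theorems of this file are tagged
`[implicit_reducible]` purely to keep them out of that index. Only other effect: they are not offered by
`+suggestions` premise selectors. No statement or proof is changed; superseded if the operator lands a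
deny-list form (`HarnessLib.PremiseIndex`). -/
set_option allowUnsafeReducibility true in
attribute [implicit_reducible]
  _root_.Literature.NumberTheory.GelbartRogawski1991.UnitaryDualPair.LocalSplitting.spFin_apply
  _root_.Literature.NumberTheory.GelbartRogawski1991.UnitaryDualPair.LocalSplitting.adeleEval_adelicForm
  _root_.Literature.NumberTheory.GelbartRogawski1991.UnitaryDualPair.LocalSplitting.adeleEval_ofSymplectic_f
  _root_.Literature.NumberTheory.GelbartRogawski1991.UnitaryDualPair.LocalSplitting.fst_ofSymplectic_f_eq_zero
  _root_.Literature.NumberTheory.GelbartRogawski1991.UnitaryDualPair.LocalSplitting.adeleAddChar_eq_finiteAdeleAddChar_of_fst_eq_zero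
  _root_.Literature.NumberTheory.GelbartRogawski1991.UnitaryDualPair.LocalSplitting.localSchrodinger_mk_eq_smul
  _root_.Literature.NumberTheory.GelbartRogawski1991.UnitaryDualPair.LocalSplitting.piProdSB_eq_smul_of_forall
  _root_.Literature.NumberTheory.GelbartRogawski1991.UnitaryDualPair.LocalSplitting.exists_eq_arch_mul_fin
  _root_.Literature.NumberTheory.GelbartRogawski1991.UnitaryDualPair.LocalSplitting.tensorFinHom_apply
  omegaLoc_apply fst_s omegaLoc_implements isSmooth_omegaLoc unitVec_mem_fixedPoints Omega_apply
  Omega_piProdSB smul_apply isLocallyConstant_Omega_apply coe_OmegaEquiv OmegaEquiv_apply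
  smul_heisFamily_apply Omega_comp_finSchrodinger implements_of_mem_finHeisenberg implements_arch
  implements pairHom_mem toOp_finSplittingMp proj_finSplittingMp finSplittingMp_mem
  proj_finSplitting coe_finSplitting omega_finSplitting omega_finSplitting_apply
  omega_finSplitting_tmul exists_omega_finSplitting_eq isLocallyConstant_omega_finSplitting
  continuous_finSplitting

end FinLocalSplittings

end Literature.NumberTheory.GelbartRogawski1991.UnitaryDualPair.LocalSplitting

end

/- build-lane note, addendum (ops-buildfix B14-5, 2026-08-22): local theorem constants the `[implicit_reducible]` block above
cannot reach — auto-realized `*.congr_simp` lemmas, structure projections / `mk.inj` / `sizeOf_spec` — are still walked by the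
`.olean` exporter's premise indexers (in-file census: FOLDED = 6, proxy 2.6e+10). A global `attribute` on a realized constant lands
on an async environment branch the exporter does not consult; this file-final, top-level `local` entry goes through the
synchronous scoped extension that `getReducibilityStatusCore` reads first and is never popped before export. It is not
exported and changes no statement or proof. -/
set_option allowUnsafeReducibility true in
attribute [local implicit_reducible]
  Literature.NumberTheory.GelbartRogawski1991.UnitaryDualPair.LocalSplitting.FinLocalSplittings.mk.injEq
  Literature.NumberTheory.GelbartRogawski1991.UnitaryDualPair.LocalSplitting.FinLocalSplittings.mk.inj
  Literature.NumberTheory.GelbartRogawski1991.UnitaryDualPair.LocalSplitting.FinLocalSplittings.mk.sizeOf_spec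
  Literature.NumberTheory.GelbartRogawski1991.UnitaryDualPair.LocalSplitting.FinLocalSplittings.proj_s
  Literature.NumberTheory.GelbartRogawski1991.UnitaryDualPair.LocalSplitting.FinLocalSplittings.unramified
  Literature.NumberTheory.GelbartRogawski1991.UnitaryDualPair.LocalSplitting.FinLocalSplittings.smooth
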